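import Summits.QuantumFields.YangMills.Theorems.FluctuationComparisonRegPrIntLS2BetaCovWalkSumStokes
import HarnessLib

/-!
# S2β · (REG-UP)′ letter (hNL) — «THE SECOND-ORDER SUP REMAINDER OF THE k-STEP TOWER FROM ONE-STEP LETTERS»: if `‖X (i+1) c − D_i (X i) c‖ ≤ r (i+1)` (one-step second order) and the
# one-step LINEAR maps have sup rows `λ_i` and are additive, then the composite `D^{(k)} = D_{k−1} ∘ ⋯ ∘ D_0` satisfies `‖X k c − D^{(k)} (X 0) c‖ ≤ e k` for ANY sequence `e` with
# `e 0 = 0`, `r (i+1) + λ_i·e i ≤ e (i+1)` — the displayed letter (hNL) `ρ₂` of ✓p840162 `hOSC_of_compositeLetters`, modulo the per-level letters (architect px17 g23 02:19:44Z gap list)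

Cell `ym3-torus` (YM ladder rung R3 = continuum `SU(2)` Yang–Mills on the three-torus at fixed lattice data — a RUNG: NOT d = 4, NOT infinite volume, NOT a mass gap,
NOT Clay).  Width seat `ym3-torus-px13` (gen 29); crux `stmt-QuantumFields-20520`, LINE g18-1 S2β, node (REG-UP)′.  `--kind proof --supports stmt-QuantumFields-20520 --as helper`,
count-neutral, DEFINITION-FREE (0 `def`, 0 `instance`, 0 `notation`, 0 `sorry`, default heartbeats).  Generic `P : Params`, matrix data `X i : PBond P i → M_N(ℂ)`.

THE LETTERS (displayed): one-step maps `Ds i : (PBond P i → M) → (PBond P (i+1) → M)` with (hadd) `Ds i (Y − Y′) = Ds i Y − Ds i Y′` and (hrow) `(∀ b, ‖Y b‖ ≤ s) → ∀ c, ‖Ds i Y c‖ ≤ λ i·s`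
[✓(D1)∕(D2) one-step: `λ i = (1+4(d+2))(1 + C·α_i)·L`]; the composite family `Dk : (i : ℕ) → (PBond P 0 → M) → (PBond P i → M)` with (hDk0) `Dk 0 Y = Y`, (hDks) `Dk (i+1) Y = Ds i (Dk i Y)`
[= `fderiv` of the k-step chart-read by the chain rule, ✓`…ChartReadDescentChainRule`]; the one-step second order (hr) `‖X (i+1) c − Ds i (X i) c‖ ≤ r (i+1)` [M-1‴'s `hR` ∕ C₆∕C₇ `R′`].

WHAT IS PROVED (sorry-free).  §2 ★★★`norm_sub_segment_le` — THE K-UNIFORM FORM by SEGMENT COMPOSITES (architect px17 g23 02:41:42Z (i)): `‖X k c − Dseg 0 k (X 0) c‖ ≤ Σ_{i<k} Λ·L^{k−1−i}·r(i+1)`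
with the segment rows `‖Dseg i k Y‖ ≤ Λ·L^{k−i}·sup‖Y‖` (px12 g27 `…ChartReadIterFromSup`) — USE THIS ONE; §1 ★★`norm_sub_composite_le` — for every `e : ℕ → ℝ` with `e 0 = 0` and `r (i+1) + λ i·e i ≤ e (i+1)` (`i < k`): `∀ i ≤ k, ∀ c, ‖X i c − Dk i (X 0) c‖ ≤ e i`
(induction: `X(i+1) − D_i(Dk i X₀) = (X(i+1) − D_i(X i)) + D_i(X i − Dk i X₀)`) — TRUE for any `e`, but its natural inhabitant compounds the one-step rows' `(1+4(d+2))` per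
level (architect's flag 02:41:42Z): K-uniform only through §2.  With `λ i ≤ Λ₁·L` and `r (i+1) ≤ C·(Lⁱ·M₀)²·L` the closed form `e k ≤ C′·L^{2k−1}·M₀²·…` is the consumer's
arithmetic (TARGET PROFILE of ✓p840162: `ρ₂ ≤ const·L^{2l}·η²` at `M₀ = η·B₁s`).

HONEST.  Triangle inequalities; every analytic input displayed; nothing of Bałaban's analysis proved ([Balaban1985Averaging] Prop. 3∕4 (121)–(131) the loci); GAP♯∘ (registry 3732b7df
UNTOUCHED, 0∕5), S2β, crux 20520, 19936, 19200, `YM3TorusSU2` — NOT proved; rung R3 — NOT d = 4, NOT infinite volume, NOT a mass gap, NOT Clay; the Yang–Mills mass gap is NOT proved.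
-/

set_option autoImplicit false

noncomputable section

open scoped Matrix.Norms.L2Operator

namespace Summit.QuantumFields.YangMills.Theorems.FluctuationComparisonRegPrIntLS2BetaSecondOrderTowerSup

open Literature.MathematicalPhysics.QuantumFieldTheory.Balaban1983to89

variable {P : Params} {N : ℕ}

/-- ★★ **THE SECOND-ORDER SUP REMAINDER OF THE k-STEP TOWER FROM ONE-STEP LETTERS.** [cite: Balaban1985Averaging, Prop. 4 (128)-(131) pp.37-38] -/
theorem norm_sub_composite_le (k : ℕ) (X : (i : ℕ) → PBond P i → Matrix (Fin N) (Fin N) ℂ)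
    (Ds : (i : ℕ) → (PBond P i → Matrix (Fin N) (Fin N) ℂ) → (PBond P (i + 1) → Matrix (Fin N) (Fin N) ℂ))
    (Dk : (i : ℕ) → (PBond P 0 → Matrix (Fin N) (Fin N) ℂ) → (PBond P i → Matrix (Fin N) (Fin N) ℂ))
    (lam r e : ℕ → ℝ)
    (hadd : ∀ i, i < k → ∀ Y Y' : PBond P i → Matrix (Fin N) (Fin N) ℂ, Ds i (fun b => Y b - Y' b) = fun c => Ds i Y c - Ds i Y' c)
    (hrow : ∀ i, i < k → ∀ (Y : PBond P i → Matrix (Fin N) (Fin N) ℂ) (s : ℝ), (∀ b, ‖Y b‖ ≤ s) → ∀ c, ‖Ds i Y c‖ ≤ lam i * s)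
    (hDk0 : ∀ Y, Dk 0 Y = Y) (hDks : ∀ i, i < k → ∀ Y, Dk (i + 1) Y = Ds i (Dk i Y))
    (hr : ∀ i, i < k → ∀ c, ‖X (i + 1) c - Ds i (X i) c‖ ≤ r (i + 1))
    (he0 : e 0 = 0) (he : ∀ i, i < k → r (i + 1) + lam i * e i ≤ e (i + 1)) :
    ∀ i, i ≤ k → ∀ c : PBond P i, ‖X i c - Dk i (X 0) c‖ ≤ e i := by
  intro i
  induction i with
  | zero => intro _ c; rw [hDk0, sub_self, norm_zero, he0]
  | succ i ih =>
    intro hi c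
    have hi' : i < k := by omega
    have hrec := ih (by omega)
    have hsplit : X (i + 1) c - Dk (i + 1) (X 0) c = (X (i + 1) c - Ds i (X i) c) + Ds i (fun b => X i b - Dk i (X 0) b) c := by
      rw [hDks i hi', hadd i hi']; dsimp only; abel
    rw [hsplit]
    refine (norm_add_le _ _).trans ((add_le_add (hr i hi' c) (hrow i hi' _ _ hrec c)).trans (he i hi'))

/-- ★ **THE SAME WITH THE CLOSED-FORM MAJORANT** `e i := Σ_{j<i} (Π_{j<t<i} λ t)·r (j+1)` is the consumer's real arithmetic; here the USE form at the top level `k` only.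
[cite: Balaban1985Averaging, Prop. 4 (128)-(131) pp.37-38] -/
theorem norm_sub_composite_le_top (k : ℕ) (X : (i : ℕ) → PBond P i → Matrix (Fin N) (Fin N) ℂ)
    (Ds : (i : ℕ) → (PBond P i → Matrix (Fin N) (Fin N) ℂ) → (PBond P (i + 1) → Matrix (Fin N) (Fin N) ℂ))
    (Dk : (i : ℕ) → (PBond P 0 → Matrix (Fin N) (Fin N) ℂ) → (PBond P i → Matrix (Fin N) (Fin N) ℂ))
    (lam r e : ℕ → ℝ)
    (hadd : ∀ i, i < k → ∀ Y Y' : PBond P i → Matrix (Fin N) (Fin N) ℂ, Ds i (fun b => Y b - Y' b) = fun c => Ds i Y c - Ds i Y' c)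
    (hrow : ∀ i, i < k → ∀ (Y : PBond P i → Matrix (Fin N) (Fin N) ℂ) (s : ℝ), (∀ b, ‖Y b‖ ≤ s) → ∀ c, ‖Ds i Y c‖ ≤ lam i * s)
    (hDk0 : ∀ Y, Dk 0 Y = Y) (hDks : ∀ i, i < k → ∀ Y, Dk (i + 1) Y = Ds i (Dk i Y))
    (hr : ∀ i, i < k → ∀ c, ‖X (i + 1) c - Ds i (X i) c‖ ≤ r (i + 1))
    (he0 : e 0 = 0) (he : ∀ i, i < k → r (i + 1) + lam i * e i ≤ e (i + 1)) (c : PBond P k) :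
    ‖X k c - Dk k (X 0) c‖ ≤ e k :=
  norm_sub_composite_le k X Ds Dk lam r e hadd hrow hDk0 hDks hr he0 he k le_rfl c


/-! ## §2 ★★★ The SEGMENT-COMPOSITE form (K-uniform: the composite row is paid once per segment, not per step) -/

/-- ★★★ **THE SECOND-ORDER SUP REMAINDER BY SEGMENT COMPOSITES** (architect px17 g23 02:41:42Z option (i), the Prop-4 road proper): with segment composites `Dseg i k = D_{k−1} ∘ ⋯ ∘ D_i`
(additive, `Dseg k k = id`, `Dseg i k = Dseg (i+1) k ∘ Ds i`) whose sup rows are `Λ·L^{k−i}` UNIFORMLY IN THE SEGMENT ([Balaban1985Averaging] Prop. 4 (130); tree: px12 g27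
`…ChartReadIterFromSup.norm_fderiv_chartReadFrom_apply_le_exp`) and one-step second order `‖X (i+1) c − Ds i (X i) c‖ ≤ r (i+1)`:
`‖X k c − Dseg 0 k (X 0) c‖ ≤ Σ_{i<k} Λ·L^{k−1−i}·r (i+1)` — the telescoping `X_k − D_{0→k}X_0 = Σ_i D_{i+1→k}(X_{i+1} − D_i X_i)`; with `r (i+1) ≤ C·L^{2i+1}·M₀²` this is
`≤ Λ·C·M₀²·L^{2k}∕(L−1)`, the TARGET PROFILE of ✓p840162's `ρ₂`, constant free of `k`. [cite: Balaban1985Averaging, Prop. 4 (128)-(131) pp.37-38] -/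
theorem norm_sub_segment_le (k : ℕ) (X : (i : ℕ) → PBond P i → Matrix (Fin N) (Fin N) ℂ)
    (Ds : (i : ℕ) → (PBond P i → Matrix (Fin N) (Fin N) ℂ) → (PBond P (i + 1) → Matrix (Fin N) (Fin N) ℂ))
    (Dseg : (i k : ℕ) → (PBond P i → Matrix (Fin N) (Fin N) ℂ) → (PBond P k → Matrix (Fin N) (Fin N) ℂ))
    (Λ : ℝ) (r : ℕ → ℝ)
    (hsegadd : ∀ i, i ≤ k → ∀ Y Y' : PBond P i → Matrix (Fin N) (Fin N) ℂ, Dseg i k (fun b => Y b - Y' b) = fun c => Dseg i k Y c - Dseg i k Y' c)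
    (hseg : ∀ i, i ≤ k → ∀ (Y : PBond P i → Matrix (Fin N) (Fin N) ℂ) (s : ℝ), (∀ b, ‖Y b‖ ≤ s) → ∀ c, ‖Dseg i k Y c‖ ≤ Λ * (P.L : ℝ) ^ (k - i) * s)
    (hsegsucc : ∀ i, i < k → ∀ Y, Dseg i k Y = Dseg (i + 1) k (Ds i Y)) (hsegkk : ∀ Y, Dseg k k Y = Y)
    (hr : ∀ i, i < k → ∀ c, ‖X (i + 1) c - Ds i (X i) c‖ ≤ r (i + 1)) (c : PBond P k) :
    ‖X k c - Dseg 0 k (X 0) c‖ ≤ ∑ i ∈ Finset.range k, Λ * (P.L : ℝ) ^ (k - 1 - i) * r (i + 1) := by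
  -- descending induction: for every `i ≤ k`, `‖X k c − Dseg i k (X i) c‖ ≤ Σ_{j ∈ [i,k)} Λ·L^{k−1−j}·r(j+1)`
  have key : ∀ n i, i + n = k → ‖X k c - Dseg i k (X i) c‖ ≤ ∑ j ∈ Finset.Ico i k, Λ * (P.L : ℝ) ^ (k - 1 - j) * r (j + 1) := by
    intro n
    induction n with
    | zero =>
      intro i hi
      rw [Nat.add_zero] at hi
      subst hi
      rw [hsegkk, sub_self, norm_zero, Finset.Ico_self, Finset.sum_empty]
    | succ n ih =>
      intro i hi
      have hik : i < k := by omega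
      have hrec := ih (i + 1) (by omega)
      have hsplit : X k c - Dseg i k (X i) c = (X k c - Dseg (i + 1) k (X (i + 1)) c) + Dseg (i + 1) k (fun b => X (i + 1) b - Ds i (X i) b) c := by
        rw [hsegsucc i hik, hsegadd (i + 1) (by omega)]; dsimp only; abel
      rw [hsplit, Finset.sum_eq_sum_Ico_succ_bot hik, add_comm (Λ * (P.L : ℝ) ^ (k - 1 - i) * r (i + 1))]
      refine (norm_add_le _ _).trans (add_le_add hrec ?_)
      have h := hseg (i + 1) (by omega) (fun b => X (i + 1) b - Ds i (X i) b) (r (i + 1)) (hr i hik) c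
      rwa [show k - (i + 1) = k - 1 - i by omega] at h
  have h := key k 0 (by omega)
  rwa [Finset.range_eq_Ico] at *

end Summit.QuantumFields.YangMills.Theorems.FluctuationComparisonRegPrIntLS2BetaSecondOrderTowerSup

end
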